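import Mathlib
import HarnessLib
import Summits.Ventures.LatticeQCDFlow.Exactness.SphereNLOFlowGenerator
import Summits.Ventures.LatticeQCDFlow.Exactness.SphereNLOFlowAction

/-!
# The next-to-leading-order generator `T⁽¹⁾ = −∂̃S̃⁽¹⁾` of the lattice CP(N−1)/O(N) model as ONE local field

HONEST FRAMING: exact (Metropolis-corrected) sampling algorithms for lattice gauge theory;
figures of merit are autocorrelation/cost numbers at stated couplings and volumes; no
continuum-physics claim.

Venture `LatticeQCDFlow` (cell pub-lqcd), topic `Exactness`; FANOUT row 7 (`s0-cpn-null`: the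
S0-D1 rung — 2D CP⁹, Lüscher's LO trivializing map inside HMC, Engel–Schaefer 2011).  NEW WORK of
the cell over Mathlib and the tree's `Exactness/SphereNLOFlowGenerator.lean` (site gradients of
the staple / cross / square TERMS) and `Exactness/SphereNLOFlowAction.lean` (the closed-form
`S̃⁽¹⁾ = −(2κ²/(d−1))·W`, `W = A/(2d−1) − B/(4d−2) − C/(4d)`); nothing is cited as a fact.
Printed counterparts, NAMED ONLY: M. Lüscher, Commun. Math. Phys. 293 (2010) 899, §3.2 eq. (3.9),
§4.2 eq. (4.4) (the generator of the trivializing flow is `−∂S̃_t`, so at order `t¹` it is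
`−∂S̃⁽¹⁾`); Engel–Schaefer, Comput. Phys. Commun. 182 (2011) 2107, §3 eqs. (14), (16) (they
implement order `0` only).

## Content (`‖x n‖ = 1` for all sites; `P_k v = tangentKick v (x k)` the tangential projection;
## `J_n = localField U n x`; no self-coupling, adjoint pairs)

The site gradients of the three lattice SUMS, collected into single local fields:
* **`siteGrad_stapleSum`** — `∂̃_k A = 2·P_k(Σ_n U_{kn}(J_n − U_{nk} x_k))` (transported neighbour
  fields with the back-tracking term removed);
* **`siteGrad_squareSum`** — `∂̃_k C = 4·P_k(Σ_m ⟪U_{km} x_m, x_k⟫ U_{km} x_m)`;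
* **`siteGrad_crossSum`** —
  `∂̃_k B = 2·P_k(⟪J_k, x_k⟫ J_k − Σ_m ⟪U_{km}x_m, x_k⟫ U_{km}x_m + Σ_n (⟪J_n, x_n⟫ − ⟪U_{nk}x_k, x_n⟫) U_{kn} x_n)`;
* **`siteGrad_nloPotential`**, **`nloGenerator_eq`** — THE NLO GENERATOR AS ONE LOCAL FIELD:
  `T⁽¹⁾_k = −∂̃_k S̃⁽¹⁾ = (2κ²/(d−1))·(∂̃_k A/(2d−1) − ∂̃_k B/(4d−2) − ∂̃_k C/(4d))` with the three
  gradients above — a sum over the neighbours and next-nearest neighbours of `k` of tangential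
  projections of transported data (the formula recorded by hand in HOME/s0-cpn-null/HANDOFF GEN-7,
  now kernel-checked).

NOT CLAIMED: the flow generated by `T⁽⁰⁾ + t·T⁽¹⁾`, its Jacobian, or any exactness / improvement
statement for a map built from it; orders `≥ 2`; anything quantitative.
-/

noncomputable section

namespace Summit.Ventures.LatticeQCDFlow.Exactness

open NormedSpace Filter InnerProductSpace
open scoped RealInnerProductSpace Topology Gradient

variable {E : Type*} [NormedAddCommGroup E] [InnerProductSpace ℝ E]
variable {Λ : Type*} [Fintype Λ] [DecidableEq Λ]

/-! ## §1 Linearity bookkeeping for the tangential projection and for `∂̃_k` through sums -/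

section Bookkeeping

omit [Fintype Λ] [DecidableEq Λ] in
/-- `P_u` is additive over finite sums. -/
theorem tangentKick_finset_sum {ι : Type*} (s : Finset ι) (v : ι → E) (u : E) :
    tangentKick (∑ i ∈ s, v i) u = ∑ i ∈ s, tangentKick (v i) u := by
  classical
  induction s using Finset.induction_on with
  | empty => simp [tangentKick_zero_left]
  | insert a s ha ih => rw [Finset.sum_insert ha, Finset.sum_insert ha, tangentKick_add, ih]

omit [Fintype Λ] [DecidableEq Λ] in
/-- `P_u` is compatible with subtraction. -/
theorem tangentKick_sub (v w u : E) : tangentKick (v - w) u = tangentKick v u - tangentKick w u := by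
  rw [sub_eq_add_neg, tangentKick_add, show -w = (-1 : ℝ) • w by simp, tangentKick_smul]
  simp [sub_eq_add_neg]

variable [FiniteDimensional ℝ E]

/-- Pushing `∂̃_k` through a triple sum of `C¹` terms. -/
theorem siteGrad_sum₃ (T : Λ → Λ → Λ → (Λ → E) → ℝ) (hT : ∀ n m m', ContDiff ℝ 1 (T n m m'))
    {x : Λ → E} {k : Λ} (hx0 : x k ≠ 0) :
    siteGrad k (fun x' => ∑ n, ∑ m, ∑ m', T n m m' x') x =
      ∑ n, ∑ m, ∑ m', siteGrad k (T n m m') x := by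
  rw [siteGrad_finset_sum (G := fun n x' => ∑ m, ∑ m', T n m m' x') _ hx0
    (fun n _ => ContDiff.sum fun m _ => ContDiff.sum fun m' _ =>
      (hT n m m').comp (contDiff_update 1 x k))]
  refine Finset.sum_congr rfl fun n _ => ?_
  rw [siteGrad_finset_sum (G := fun m x' => ∑ m', T n m m' x') _ hx0
    (fun m _ => ContDiff.sum fun m' _ => (hT n m m').comp (contDiff_update 1 x k))]
  refine Finset.sum_congr rfl fun m _ => ?_
  exact siteGrad_finset_sum _ hx0 fun m' _ => (hT n m m').comp (contDiff_update 1 x k)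

/-- Pushing `∂̃_k` through a double sum of `C¹` terms. -/
theorem siteGrad_sum₂ (T : Λ → Λ → (Λ → E) → ℝ) (hT : ∀ n m, ContDiff ℝ 1 (T n m))
    {x : Λ → E} {k : Λ} (hx0 : x k ≠ 0) :
    siteGrad k (fun x' => ∑ n, ∑ m, T n m x') x = ∑ n, ∑ m, siteGrad k (T n m) x := by
  rw [siteGrad_finset_sum (G := fun n x' => ∑ m, T n m x') _ hx0
    (fun n _ => ContDiff.sum fun m _ => (hT n m).comp (contDiff_update 1 x k))]
  refine Finset.sum_congr rfl fun n _ => ?_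
  exact siteGrad_finset_sum _ hx0 fun m _ => (hT n m).comp (contDiff_update 1 x k)

omit [Fintype Λ] in
/-- `∂̃_n (G − H) = ∂̃_n G − ∂̃_n H` for summands `C¹` in the site variable (`x_n ≠ 0`). -/
theorem siteGrad_sub {G H : (Λ → E) → ℝ} {x : Λ → E} {n : Λ} (hx : x n ≠ 0)
    (hG : ContDiff ℝ 1 (fun y => G (Function.update x n y)))
    (hH : ContDiff ℝ 1 (fun y => H (Function.update x n y))) :
    siteGrad n (fun x' => G x' - H x') x = siteGrad n G x - siteGrad n H x := by
  unfold siteGrad gradient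
  rw [← map_sub]
  congr 1
  exact fderiv_sub (differentiableAt_section_comp_normalize hx hG)
    (differentiableAt_section_comp_normalize hx hH)

end Bookkeeping

/-! ## §2 The site gradients of the three sums, collected -/

section Sums

variable [FiniteDimensional ℝ E] {U : Λ → Λ → (E →L[ℝ] E)}

omit [Fintype Λ] in
/-- The diagonal staple term is identically zero, so its gradient vanishes. -/
theorem siteGrad_stapleTerm_diag (n m k : Λ) (x : Λ → E) :
    siteGrad k (stapleTerm U n m m) x = 0 :=
  siteGrad_of_const (c := 0) fun y => by simp [stapleTerm]

omit [Fintype Λ] in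
/-- The diagonal cross term is identically zero, so its gradient vanishes. -/
theorem siteGrad_crossTerm_diag (n m k : Λ) (x : Λ → E) :
    siteGrad k (crossTerm U n m m) x = 0 :=
  siteGrad_of_const (c := 0) fun y => by simp [crossTerm]

/-- **Staple terms around one site `n`, summed**:
`Σ_m Σ_{m'} ∂̃_k a(n,m,m') = 2·P_k(U_{kn}(J_n − U_{nk} x_k))`. -/
theorem sum_sum_siteGrad_stapleTerm (hUadj : ∀ m n (v w : E), ⟪U m n v, w⟫ = ⟪v, U n m w⟫)
    (n k : Λ) {x : Λ → E} (hx : ‖x k‖ = 1) :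
    ∑ m, ∑ m', siteGrad k (stapleTerm U n m m') x =
      (2 : ℝ) • tangentKick (U k n (localField U n x - U n k (x k))) (x k) := by
  have hleft : ∀ m', m' ≠ k →
      siteGrad k (stapleTerm U n k m') x = tangentKick (U k n (U n m' (x m'))) (x k) :=
    fun m' h => siteGrad_stapleTerm_left hUadj (Ne.symm h) hx
  have hright : ∀ m, m ≠ k →
      siteGrad k (stapleTerm U n m k) x = tangentKick (U k n (U n m (x m))) (x k) :=
    fun m h => siteGrad_stapleTerm_right hUadj h hx
  have hrow_k : ∑ m', siteGrad k (stapleTerm U n k m') x =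
      ∑ m' ∈ Finset.univ.erase k, tangentKick (U k n (U n m' (x m'))) (x k) := by
    rw [← Finset.add_sum_erase _ _ (Finset.mem_univ k), siteGrad_stapleTerm_diag, zero_add]
    exact Finset.sum_congr rfl fun m' hm' => hleft m' (Finset.ne_of_mem_erase hm')
  have hrow_m : ∀ m ∈ Finset.univ.erase k, ∑ m', siteGrad k (stapleTerm U n m m') x =
      tangentKick (U k n (U n m (x m))) (x k) := by
    intro m hm
    have hmk : m ≠ k := Finset.ne_of_mem_erase hm
    rw [← Finset.add_sum_erase _ _ (Finset.mem_univ k), hright m hmk,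
      Finset.sum_eq_zero fun m' hm' =>
        siteGrad_stapleTerm_other (Ne.symm hmk) (Ne.symm (Finset.ne_of_mem_erase hm')) x,
      add_zero]
  rw [← Finset.add_sum_erase _ _ (Finset.mem_univ k), hrow_k, Finset.sum_congr rfl hrow_m,
    ← two_smul ℝ, ← tangentKick_finset_sum, ← map_sum,
    Finset.sum_erase_eq_sub (Finset.mem_univ k)]
  rfl

/-- **`∂̃_k A = 2·P_k(Σ_n U_{kn}(J_n − U_{nk} x_k))`** — the site gradient of the staple sum. -/
theorem siteGrad_stapleSum (hUadj : ∀ m n (v w : E), ⟪U m n v, w⟫ = ⟪v, U n m w⟫)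
    {x : Λ → E} (hx : ∀ n, ‖x n‖ = 1) (k : Λ) :
    siteGrad k (stapleSum U) x =
      (2 : ℝ) • tangentKick (∑ n, U k n (localField U n x - U n k (x k))) (x k) := by
  have hx0 : x k ≠ 0 := ne_zero_of_norm_ne_zero (by rw [hx k]; exact one_ne_zero)
  unfold stapleSum
  rw [siteGrad_sum₃ _ (fun n m m' => contDiff_stapleTerm U n m m') hx0]
  simp_rw [sum_sum_siteGrad_stapleTerm hUadj _ k (hx k)]
  rw [← Finset.smul_sum, ← tangentKick_finset_sum]

/-- **Square terms around one site: `n = k`**: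
`Σ_m ∂̃_k c(k,m) = Σ_m P_k(2⟪U_{km}x_m, x_k⟫ U_{km}x_m)`. -/
theorem sum_siteGrad_squareTerm_self (hU0 : ∀ n, U n n = 0) (k : Λ) {x : Λ → E}
    (hx : ‖x k‖ = 1) :
    ∑ m, siteGrad k (squareTerm U k m) x =
      ∑ m, tangentKick ((2 * ⟪U k m (x m), x k⟫) • U k m (x m)) (x k) :=
  Finset.sum_congr rfl fun m _ => siteGrad_squareTerm_self hU0 k m hx

/-- **Square terms around another site `n ≠ k`**: only `m = k` contributes,
`Σ_m ∂̃_k c(n,m) = P_k(2⟪U_{kn}x_n, x_k⟫ U_{kn}x_n)`. -/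
theorem sum_siteGrad_squareTerm_other (hUadj : ∀ m n (v w : E), ⟪U m n v, w⟫ = ⟪v, U n m w⟫)
    {n k : Λ} (hnk : n ≠ k) {x : Λ → E} (hx : ‖x k‖ = 1) :
    ∑ m, siteGrad k (squareTerm U n m) x =
      tangentKick ((2 * ⟪U k n (x n), x k⟫) • U k n (x n)) (x k) := by
  rw [← Finset.add_sum_erase _ _ (Finset.mem_univ k),
    siteGrad_squareTerm_other_site hUadj (Ne.symm hnk) hx,
    Finset.sum_eq_zero fun m hm =>
      siteGrad_squareTerm_other (Ne.symm hnk) (Ne.symm (Finset.ne_of_mem_erase hm)) x,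
    add_zero]

/-- **`∂̃_k C = 4·P_k(Σ_m ⟪U_{km}x_m, x_k⟫ U_{km}x_m)`** — the site gradient of the square sum. -/
theorem siteGrad_squareSum (hU0 : ∀ n, U n n = 0)
    (hUadj : ∀ m n (v w : E), ⟪U m n v, w⟫ = ⟪v, U n m w⟫) {x : Λ → E} (hx : ∀ n, ‖x n‖ = 1)
    (k : Λ) :
    siteGrad k (squareSum U) x =
      (4 : ℝ) • tangentKick (∑ m, ⟪U k m (x m), x k⟫ • U k m (x m)) (x k) := by
  have hx0 : x k ≠ 0 := ne_zero_of_norm_ne_zero (by rw [hx k]; exact one_ne_zero)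
  unfold squareSum
  rw [siteGrad_sum₂ _ (fun n m => contDiff_squareTerm U n m) hx0,
    ← Finset.add_sum_erase _ _ (Finset.mem_univ k), sum_siteGrad_squareTerm_self hU0 k (hx k)]
  have hother : ∑ n ∈ Finset.univ.erase k, ∑ m, siteGrad k (squareTerm U n m) x =
      ∑ n ∈ Finset.univ.erase k, tangentKick ((2 * ⟪U k n (x n), x k⟫) • U k n (x n)) (x k) :=
    Finset.sum_congr rfl fun n hn => sum_siteGrad_squareTerm_other hUadj (Finset.ne_of_mem_erase hn)
      (hx k)
  have hkk : tangentKick ((2 * ⟪U k k (x k), x k⟫) • U k k (x k)) (x k) = 0 := by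
    rw [hU0 k]; simp [tangentKick_zero_left]
  rw [hother, Finset.sum_erase_eq_sub (Finset.mem_univ k), hkk, sub_zero, ← two_smul ℝ,
    tangentKick_finset_sum, Finset.smul_sum, Finset.smul_sum]
  refine Finset.sum_congr rfl fun m _ => ?_
  rw [tangentKick_smul, tangentKick_smul, smul_smul, smul_smul]
  congr 1
  ring

/-- **Cross terms around one site: `n = k`**:
`Σ_m Σ_{m'} ∂̃_k b(k,m,m') = 2·P_k(⟪J_k, x_k⟫ J_k − Σ_m ⟪U_{km}x_m, x_k⟫ U_{km}x_m)`. -/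
theorem sum_sum_siteGrad_crossTerm_self (hU0 : ∀ n, U n n = 0) (k : Λ) {x : Λ → E}
    (hx : ‖x k‖ = 1) :
    ∑ m, ∑ m', siteGrad k (crossTerm U k m m') x =
      (2 : ℝ) • tangentKick (⟪localField U k x, x k⟫ • localField U k x -
        ∑ m, ⟪U k m (x m), x k⟫ • U k m (x m)) (x k) := by
  -- every term: `P_k(v m m')` minus the diagonal correction
  have hterm : ∀ m m', siteGrad k (crossTerm U k m m') x =
      tangentKick (⟪U k m' (x m'), x k⟫ • U k m (x m) + ⟪U k m (x m), x k⟫ • U k m' (x m')) (x k) -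
        if m = m' then tangentKick (⟪U k m' (x m'), x k⟫ • U k m (x m) +
          ⟪U k m (x m), x k⟫ • U k m' (x m')) (x k) else 0 := by
    intro m m'
    by_cases h : m = m'
    · subst h; rw [if_pos rfl, siteGrad_crossTerm_diag, sub_self]
    · rw [if_neg h, sub_zero]; exact siteGrad_crossTerm_self hU0 h hx
  have hsplit : ∑ m, ∑ m', siteGrad k (crossTerm U k m m') x =
      ∑ m, ∑ m', tangentKick (⟪U k m' (x m'), x k⟫ • U k m (x m) +
        ⟪U k m (x m), x k⟫ • U k m' (x m')) (x k) -
      ∑ m, tangentKick (⟪U k m (x m), x k⟫ • U k m (x m) +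
        ⟪U k m (x m), x k⟫ • U k m (x m)) (x k) := by
    rw [← Finset.sum_sub_distrib]
    refine Finset.sum_congr rfl fun m _ => ?_
    rw [Finset.sum_congr rfl fun m' _ => hterm m m', Finset.sum_sub_distrib, Finset.sum_ite_eq]
    simp only [Finset.mem_univ, if_true]
  rw [hsplit]
  -- the full double sum
  have hfull : ∑ m, ∑ m', tangentKick (⟪U k m' (x m'), x k⟫ • U k m (x m) +
      ⟪U k m (x m), x k⟫ • U k m' (x m')) (x k) =
      (2 : ℝ) • tangentKick (⟪localField U k x, x k⟫ • localField U k x) (x k) := by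
    simp_rw [← tangentKick_finset_sum]
    rw [two_smul, ← tangentKick_add]
    congr 1
    simp_rw [Finset.sum_add_distrib]
    have h1 : ∑ m, ∑ m', ⟪U k m' (x m'), x k⟫ • U k m (x m) =
        ⟪localField U k x, x k⟫ • localField U k x := by
      simp_rw [← Finset.sum_smul]
      rw [← Finset.smul_sum, ← sum_inner]; rfl
    have h2 : ∑ m, ∑ m', ⟪U k m (x m), x k⟫ • U k m' (x m') =
        ⟪localField U k x, x k⟫ • localField U k x := by
      simp_rw [← Finset.smul_sum]
      rw [← Finset.sum_smul, ← sum_inner]; rfl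
    rw [h1, h2]
  -- the diagonal
  have hdiag : ∑ m, tangentKick (⟪U k m (x m), x k⟫ • U k m (x m) +
      ⟪U k m (x m), x k⟫ • U k m (x m)) (x k) =
      (2 : ℝ) • tangentKick (∑ m, ⟪U k m (x m), x k⟫ • U k m (x m)) (x k) := by
    rw [two_smul, ← tangentKick_add, ← Finset.sum_add_distrib, tangentKick_finset_sum]
  rw [hfull, hdiag, ← smul_sub, ← tangentKick_sub]

/-- **Cross terms around another site `n ≠ k`**: only `m = k` or `m' = k` contribute,
`Σ_m Σ_{m'} ∂̃_k b(n,m,m') = 2·(⟪J_n, x_n⟫ − ⟪U_{nk}x_k, x_n⟫)·P_k(U_{kn}x_n)`. -/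
theorem sum_sum_siteGrad_crossTerm_other
    (hUadj : ∀ m n (v w : E), ⟪U m n v, w⟫ = ⟪v, U n m w⟫) {n k : Λ} (hnk : n ≠ k) {x : Λ → E}
    (hx : ‖x k‖ = 1) :
    ∑ m, ∑ m', siteGrad k (crossTerm U n m m') x =
      (2 : ℝ) • ((⟪localField U n x, x n⟫ - ⟪U n k (x k), x n⟫) • tangentKick (U k n (x n)) (x k)) := by
  have hleft : ∀ m', m' ≠ k → siteGrad k (crossTerm U n k m') x =
      tangentKick (⟪U n m' (x m'), x n⟫ • U k n (x n)) (x k) :=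
    fun m' h => siteGrad_crossTerm_left hUadj (Ne.symm h) (Ne.symm hnk) hx
  have hright : ∀ m, m ≠ k → siteGrad k (crossTerm U n m k) x =
      tangentKick (⟪U n m (x m), x n⟫ • U k n (x n)) (x k) :=
    fun m h => siteGrad_crossTerm_right hUadj h (Ne.symm hnk) hx
  have hrow_k : ∑ m', siteGrad k (crossTerm U n k m') x =
      ∑ m' ∈ Finset.univ.erase k, tangentKick (⟪U n m' (x m'), x n⟫ • U k n (x n)) (x k) := by
    rw [← Finset.add_sum_erase _ _ (Finset.mem_univ k), siteGrad_crossTerm_diag, zero_add]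
    exact Finset.sum_congr rfl fun m' hm' => hleft m' (Finset.ne_of_mem_erase hm')
  have hrow_m : ∀ m ∈ Finset.univ.erase k, ∑ m', siteGrad k (crossTerm U n m m') x =
      tangentKick (⟪U n m (x m), x n⟫ • U k n (x n)) (x k) := by
    intro m hm
    have hmk : m ≠ k := Finset.ne_of_mem_erase hm
    rw [← Finset.add_sum_erase _ _ (Finset.mem_univ k), hright m hmk,
      Finset.sum_eq_zero fun m' hm' => siteGrad_crossTerm_other (Ne.symm hnk) (Ne.symm hmk)
        (Ne.symm (Finset.ne_of_mem_erase hm')) x,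
      add_zero]
  rw [← Finset.add_sum_erase _ _ (Finset.mem_univ k), hrow_k, Finset.sum_congr rfl hrow_m,
    ← two_smul ℝ]
  congr 1
  simp_rw [tangentKick_smul]
  rw [← Finset.sum_smul, Finset.sum_erase_eq_sub (Finset.mem_univ k), ← sum_inner]
  rfl

/-- **`∂̃_k B = 2·P_k(⟪J_k,x_k⟫J_k − Σ_m⟪U_{km}x_m,x_k⟫U_{km}x_m + Σ_n(⟪J_n,x_n⟫ − ⟪U_{nk}x_k,x_n⟫)U_{kn}x_n)`**
— the site gradient of the cross sum. -/
theorem siteGrad_crossSum (hU0 : ∀ n, U n n = 0)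
    (hUadj : ∀ m n (v w : E), ⟪U m n v, w⟫ = ⟪v, U n m w⟫) {x : Λ → E} (hx : ∀ n, ‖x n‖ = 1)
    (k : Λ) :
    siteGrad k (crossSum U) x =
      (2 : ℝ) • tangentKick (⟪localField U k x, x k⟫ • localField U k x -
        ∑ m, ⟪U k m (x m), x k⟫ • U k m (x m) +
        ∑ n, (⟪localField U n x, x n⟫ - ⟪U n k (x k), x n⟫) • U k n (x n)) (x k) := by
  have hx0 : x k ≠ 0 := ne_zero_of_norm_ne_zero (by rw [hx k]; exact one_ne_zero)
  unfold crossSum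
  rw [siteGrad_sum₃ _ (fun n m m' => contDiff_crossTerm U n m m') hx0,
    ← Finset.add_sum_erase _ _ (Finset.mem_univ k), sum_sum_siteGrad_crossTerm_self hU0 k (hx k)]
  have hother : ∑ n ∈ Finset.univ.erase k, ∑ m, ∑ m', siteGrad k (crossTerm U n m m') x =
      ∑ n ∈ Finset.univ.erase k, (2 : ℝ) • ((⟪localField U n x, x n⟫ - ⟪U n k (x k), x n⟫) •
        tangentKick (U k n (x n)) (x k)) :=
    Finset.sum_congr rfl fun n hn =>
      sum_sum_siteGrad_crossTerm_other hUadj (Finset.ne_of_mem_erase hn) (hx k)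
  have hkk : (2 : ℝ) • ((⟪localField U k x, x k⟫ - ⟪U k k (x k), x k⟫) •
      tangentKick (U k k (x k)) (x k)) = 0 := by
    rw [hU0 k]; simp [tangentKick_zero_left]
  rw [hother, Finset.sum_erase_eq_sub (Finset.mem_univ k), hkk, sub_zero, ← Finset.smul_sum,
    ← smul_add]
  congr 1
  simp_rw [← tangentKick_smul]
  rw [← tangentKick_finset_sum, ← tangentKick_add]

end Sums

/-! ## §3 The NLO generator as one local field -/

section Generator

variable [FiniteDimensional ℝ E] {U : Λ → Λ → (E →L[ℝ] E)}

/-- **The site gradient of the NLO potential** `W = A/(2d−1) − B/(4d−2) − C/(4d)`: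
`∂̃_k W = ∂̃_k A/(2d−1) − ∂̃_k B/(2(2d−1)) − ∂̃_k C/(4d)` with the three collected gradients. -/
theorem siteGrad_nloPotential (hU0 : ∀ n, U n n = 0)
    (hUadj : ∀ m n (v w : E), ⟪U m n v, w⟫ = ⟪v, U n m w⟫) {x : Λ → E} (hx : ∀ n, ‖x n‖ = 1)
    (k : Λ) :
    siteGrad k (nloPotential U) x =
      (2 * (Module.finrank ℝ E : ℝ) - 1)⁻¹ •
          ((2 : ℝ) • tangentKick (∑ n, U k n (localField U n x - U n k (x k))) (x k)) -
        (2 * (2 * (Module.finrank ℝ E : ℝ) - 1))⁻¹ •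
          ((2 : ℝ) • tangentKick (⟪localField U k x, x k⟫ • localField U k x -
            ∑ m, ⟪U k m (x m), x k⟫ • U k m (x m) +
            ∑ n, (⟪localField U n x, x n⟫ - ⟪U n k (x k), x n⟫) • U k n (x n)) (x k)) -
        (4 * (Module.finrank ℝ E : ℝ))⁻¹ •
          ((4 : ℝ) • tangentKick (∑ m, ⟪U k m (x m), x k⟫ • U k m (x m)) (x k)) := by
  have hx0 : x k ≠ 0 := ne_zero_of_norm_ne_zero (by rw [hx k]; exact one_ne_zero)
  obtain ⟨hA, hB, hC⟩ := contDiff_sums (E := E) U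
  have hA1 : ContDiff ℝ 1 (fun y => stapleSum U (Function.update x k y)) :=
    (hA.of_le (by norm_num)).comp (contDiff_update 1 x k)
  have hB1 : ContDiff ℝ 1 (fun y => crossSum U (Function.update x k y)) :=
    (hB.of_le (by norm_num)).comp (contDiff_update 1 x k)
  have hC1 : ContDiff ℝ 1 (fun y => squareSum U (Function.update x k y)) :=
    (hC.of_le (by norm_num)).comp (contDiff_update 1 x k)
  unfold nloPotential
  rw [siteGrad_sub (G := fun x' => (2 * (Module.finrank ℝ E : ℝ) - 1)⁻¹ * stapleSum U x' -
        (2 * (2 * (Module.finrank ℝ E : ℝ) - 1))⁻¹ * crossSum U x')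
      (H := fun x' => (4 * (Module.finrank ℝ E : ℝ))⁻¹ * squareSum U x') (x := x) (n := k) hx0
      ((contDiff_const.mul hA1).sub (contDiff_const.mul hB1)) (contDiff_const.mul hC1),
    siteGrad_sub (G := fun x' => (2 * (Module.finrank ℝ E : ℝ) - 1)⁻¹ * stapleSum U x')
      (H := fun x' => (2 * (2 * (Module.finrank ℝ E : ℝ) - 1))⁻¹ * crossSum U x') (x := x) (n := k)
      hx0 (contDiff_const.mul hA1) (contDiff_const.mul hB1),
    siteGrad_const_mul (G := stapleSum U) (x := x) (n := k) hx0 hA1,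
    siteGrad_const_mul (G := crossSum U) (x := x) (n := k) hx0 hB1,
    siteGrad_const_mul (G := squareSum U) (x := x) (n := k) hx0 hC1,
    siteGrad_stapleSum hUadj hx k, siteGrad_crossSum hU0 hUadj hx k,
    siteGrad_squareSum hU0 hUadj hx k]

/-- **THE NLO GENERATOR AS ONE LOCAL FIELD**: `T⁽¹⁾_k = −∂̃_k S̃⁽¹⁾ = (2κ²/(d−1))·∂̃_k W` with
`∂̃_k W` the explicit sum of tangential projections of `siteGrad_nloPotential` (neighbours and
next-nearest neighbours of `k` through the transporters `U`). -/
theorem nloGenerator_eq (κ : ℝ) {x : Λ → E} (hx : ∀ n, ‖x n‖ = 1) (k : Λ) :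
    -siteGrad k (nloFlowAction κ U) x =
      (2 * κ ^ 2 / ((Module.finrank ℝ E : ℝ) - 1)) • siteGrad k (nloPotential U) x := by
  have hx0 : x k ≠ 0 := ne_zero_of_norm_ne_zero (by rw [hx k]; exact one_ne_zero)
  obtain ⟨hA, hB, hC⟩ := contDiff_sums (E := E) U
  have hW : ContDiff ℝ 1 (fun y => nloPotential U (Function.update x k y)) := by
    have hW2 : ContDiff ℝ 2 (nloPotential U) := by
      unfold nloPotential
      exact ((contDiff_const.mul hA).sub (contDiff_const.mul hB)).sub (contDiff_const.mul hC)
    exact (hW2.of_le (by norm_num)).comp (contDiff_update 1 x k)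
  unfold nloFlowAction
  rw [siteGrad_const_mul (G := nloPotential U) (x := x) (n := k) hx0 hW, ← neg_smul, neg_neg]

end Generator

end Summit.Ventures.LatticeQCDFlow.Exactness

end
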